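/-
COR-CM (cell pub-hodgecm2, stage 2 of the Hodge ladder) — count-neutral KERNEL COMBINATORICS «field level of the SHEARED DIHEDRAL LAW: exactly φ₂(F)
generating faces for the groups X_n, n odd ≥ 3» (seat prover-pub-hodgecm2-b23-g52-0, binder prover b23, gen 52; own census lane, claim HOME/INBOX.md
l.23708, blanket top-level `CorCM/FaceShearedDihedral*` l.23712).  Theorems only; `Census/ShearedDihedralLaw.lean` (this seat, part XXII),
`CorCM/FaceShearedDihedral.lean` (`exists_datum_of_aut`), the field transfer `CorCM/FaceGenerationTransfer.lean` and seat b09ʼs coinvariant floor are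
used BY NAME; nothing asserted.  `Interfaces.lean` (C1), every E term, B01, `Transposition/*`, `PortJoin/*`, `D2Bridge/*` untouched.
HONEST FRAMING: `HC_CM` is NOT proved, here or anywhere in the tree; this file produces no period and proves no face period for any field; §2 is a
CONDITIONAL reading (face periods ⟹ HC for the dominated slice), exactly like the other INT2-GEN socket files.
T5: n/a-class (hypothesis binders: a `ShearedDihedral.Datum (GalT F) conjT n` with `n` odd `≥ 3` — inhabited by the Galois translates of any Galois CM
field with group `X_n = ℤ/n ⋊ D₄` (Klein kernel) and complex conjugation `gⁿ`, e.g. `X_3` of order 24 —, resp. three automorphisms with the six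
relations and `[F:ℚ] = 8n`; checker: self, 2026-08-25).
-/
import Summits.HodgeConjecture.CorCM.Census.ShearedDihedralLaw
import Summits.HodgeConjecture.CorCM.FaceShearedDihedral
import Summits.HodgeConjecture.CorCM.FaceSylowTransfer
import HarnessLib

/-!
# Galois CM fields with group `X_n` (`n` odd `≥ 3`, conjugation `gⁿ`): exactly `φ₂(F) = β(F) − 2` generating faces

Let `F` be a Galois CM field whose Galois translates carry a sheared dihedral datum (`Census/ShearedDihedralDatum.lean`) at an ODD level `n ≥ 3`:
`Gal(F/ℚ) ≅ X_n = ⟨g, s, x | g²ⁿ = s² = x² = 1, gs = sg, xgx = g⁻¹, xsx = gⁿs⟩ ≅ ℤ/n ⋊ D₄` of order `8n`, complex conjugation `c = gⁿ ∈ [Gal, Gal]`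
(degree 24 for `X_3`; degree `8p` for the groups `X_p` left open by gen 51ʼs order-`8p` census).
* §1 **`isLeast_card_faces_hgen_of_sheared`**: the least cardinality of a face set satisfying INT2-GENʼs generation binder `hgen(𝒮, σ₀)` is EXACTLY
  `φ₂(F) = β(F) − 2` (THE SHEARED DIHEDRAL LAW of part XXII carried to the field by `FaceTransfer.isLeast_card_faces_hgen_of_intrinsic`); automorphism
  form; row **degree 24, group `X_3`: exactly `192` faces**.
* §2 **CONDITIONAL Hodge-conjecture reading** through the INT2-GEN socket: periods of those `φ₂(K)` faces ⟹ HC for every abelian variety dominated by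
  a product of CM abelian varieties with CM by subfields of `K` (`hodgeConjectureFor_of_aut_sheared_of_exists_facePeriod`).  `HC_CM` is NOT proved.

## References
* [Pohlmann1968] H. Pohlmann, Algebraic cycles on abelian varieties of complex multiplication type, Ann. of Math. 88 (1968), Thm 1.
* [Milne1999] J. S. Milne, Lefschetz motives and the Tate conjecture, Compositio Math. 117 (1999), Prop. 2.1, p. 54.
-/

open CategoryTheory NumberField NumberField.ComplexEmbedding
open Literature.AlgebraicGeometry Literature.AlgebraicGeometry.Motives Literature.AlgebraicGeometry.HodgeTheory
open Literature.AlgebraicGeometry.ComplexMultiplication Literature.AlgebraicGeometry.Milne1999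
open Summit.HodgeConjecture.CorCM.Domination

namespace Summit.HodgeConjecture.CorCM.FaceShearedDihedral

open Summit.HodgeConjecture.CorCM.Prior.AllgGroup.RfwfAllgGroup
open Summit.HodgeConjecture.CorCM.Census.BlockParity
open Summit.HodgeConjecture.CorCM.Census.Coinvariant
open Summit.HodgeConjecture.CorCM.Census
open Summit.HodgeConjecture.CorCM.FaceCensus.OddSlice (galTOfAut galTOfAut_mul galTOfAut_conjAut)

noncomputable section

section Field

variable {F : Type} [Field F] [NumberField F] {n : ℕ}

/-! ## §1 Exactly `φ₂(F)` generating faces -/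

/-- **GALOIS CM FIELDS WITH GROUP `X_n`, `n` ODD `≥ 3` (conjugation `gⁿ`) ⟹ EXACTLY `φ₂(F) = β(F) − 2` GENERATING FACES.** [folklore] -/
theorem isLeast_card_faces_hgen_of_sheared [IsCMField F] [IsGalois ℚ F] (hn : Odd n) (h3 : 3 ≤ n)
    (D : ShearedDihedral.Datum (GalT F) conjT n) (σ₀ : F →+* ℂ) :
    IsLeast {k : ℕ | ∃ 𝒮 : Finset (Face F), 𝒮.card = k ∧
      ∀ f : Face F, lefChar f.corner (fun _ => ({σ₀} : Finset (F →+* ℂ))) ∈ AddSubgroup.closure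
        {a : Asym F | ∃ g ∈ (𝒮 : Set (Face F)), ∃ σ : F →+* ℂ, a = lefChar g.corner (fun _ => ({σ} : Finset (F →+* ℂ)))}}
      (fibreTwo (conjT : GalT F) conjT_mul_self) := by
  refine FaceTransfer.isLeast_card_faces_hgen_of_intrinsic _ ?_ (fun S₀ hS₀ hS => ?_) σ₀
  · obtain ⟨S, hS, hcard, hgen⟩ := (D.isLeast_card_gfaces_generate hn h3 conjT_mul_self).1
    exact ⟨S, hS, hcard.le, hgen⟩
  · exact fibreTwo_le_card conjT conjT_mul_self D.hcen S₀ (Submodule.span ℤ (pairSet conjT)) le_rfl hS₀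
      (fun y hy => hS (gfaceSet_subset_hodgeSpan conjT conjT_mul_self hy))

/-- The same with the target written as `β(F) − 2`. [folklore] -/
theorem isLeast_card_faces_hgen_of_sheared_card_block_sub_two [IsCMField F] [IsGalois ℚ F] (hn : Odd n) (h3 : 3 ≤ n)
    (D : ShearedDihedral.Datum (GalT F) conjT n) (σ₀ : F →+* ℂ) :
    IsLeast {k : ℕ | ∃ 𝒮 : Finset (Face F), 𝒮.card = k ∧
      ∀ f : Face F, lefChar f.corner (fun _ => ({σ₀} : Finset (F →+* ℂ))) ∈ AddSubgroup.closure
        {a : Asym F | ∃ g ∈ (𝒮 : Set (Face F)), ∃ σ : F →+* ℂ, a = lefChar g.corner (fun _ => ({σ} : Finset (F →+* ℂ)))}}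
      (Fintype.card (Block (conjT : GalT F)) - 2) := by
  rw [← D.fibreTwo_eq_card_block_sub_two conjT_mul_self]
  exact isLeast_card_faces_hgen_of_sheared hn h3 D σ₀

/-- **Row degree 24, group `X_3 = ℤ/3 ⋊ D₄` (Klein kernel), conjugation `g³`: EXACTLY `192` generating faces** (`β = 194`). [folklore] -/
theorem isLeast_card_faces_hgen_oneHundredNinetyTwo [IsCMField F] [IsGalois ℚ F] (D : ShearedDihedral.Datum (GalT F) conjT 3) (σ₀ : F →+* ℂ) :
    IsLeast {k : ℕ | ∃ 𝒮 : Finset (Face F), 𝒮.card = k ∧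
      ∀ f : Face F, lefChar f.corner (fun _ => ({σ₀} : Finset (F →+* ℂ))) ∈ AddSubgroup.closure
        {a : Asym F | ∃ g ∈ (𝒮 : Set (Face F)), ∃ σ : F →+* ℂ, a = lefChar g.corner (fun _ => ({σ} : Finset (F →+* ℂ)))}} 192 := by
  rw [← (D.card_block_eq_oneHundredNinetyFour conjT_mul_self).2]
  exact isLeast_card_faces_hgen_of_sheared (by decide) le_rfl D σ₀

/-- **… automorphism form**: `[F:ℚ] = 8n` (`n` odd `≥ 3`) and automorphisms `g₀, s₀, x₀` with the six relations of `X_n`, `g₀ⁿ` inducing complex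
conjugation at `σ₀`. [folklore] -/
theorem isLeast_card_faces_hgen_of_aut_sheared [IsCMField F] [IsGalois ℚ F] (σ₀ : F →+* ℂ) (hn : Odd n) (h3 : 3 ≤ n)
    (g₀ s₀ x₀ : F ≃ₐ[ℚ] F) (hord : orderOf g₀ = 2 * n) (hcσ : σ₀.comp ((g₀ ^ n : F ≃ₐ[ℚ] F) : F →+* F) = conjugate σ₀)
    (hs2 : s₀ * s₀ = 1) (hgs : g₀ * s₀ = s₀ * g₀) (hs : s₀ ∉ Subgroup.zpowers g₀) (hx2 : x₀ * x₀ = 1) (hxg : x₀ * g₀ * x₀⁻¹ = g₀⁻¹)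
    (hxs : x₀ * s₀ * x₀⁻¹ = g₀ ^ n * s₀) (hx : ∀ i j : ℕ, x₀ ≠ g₀ ^ i * s₀ ^ j) (hdeg : Module.finrank ℚ F = 8 * n) :
    IsLeast {k : ℕ | ∃ 𝒮 : Finset (Face F), 𝒮.card = k ∧
      ∀ f : Face F, lefChar f.corner (fun _ => ({σ₀} : Finset (F →+* ℂ))) ∈ AddSubgroup.closure
        {a : Asym F | ∃ g ∈ (𝒮 : Set (Face F)), ∃ σ : F →+* ℂ, a = lefChar g.corner (fun _ => ({σ} : Finset (F →+* ℂ)))}}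
      (fibreTwo (conjT : GalT F) conjT_mul_self) := by
  obtain ⟨D⟩ := exists_datum_of_aut σ₀ g₀ s₀ x₀ hord hcσ hs2 hgs hs hx2 hxg hxs hx hdeg
  exact isLeast_card_faces_hgen_of_sheared hn h3 D σ₀

end Field

/-! ## §2 The Hodge-conjecture reading through the INT2-GEN socket (conditional on the face periods) -/

/-- **HC for the slice of a Galois CM field with group `X_n` (`n` odd `≥ 3`, degree `8n`, conjugation `gⁿ`), from `φ₂(K)` face periods** (CONDITIONAL;
`HC_CM` is NOT proved). [cite: Shimura1998, §6.2 Theorem 3 and §6.1 Corollary of Theorem 2 (pp. 41–43)] [cite: Pohlmann1968, Thm. 1]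
[cite: Milne1999LefschetzClasses, Thm. 3.2 and Cor. 4.5] [cite: MumfordAV1970, §19 Thm. 1 and p. 169] -/
theorem hodgeConjectureFor_of_aut_sheared_of_exists_facePeriod (K : CMField) [hGal : IsGalois ℚ K] (σ₀ : (K : Type) →+* ℂ) {n : ℕ}
    (hn : Odd n) (h3 : 3 ≤ n) (g₀ s₀ x₀ : (K : Type) ≃ₐ[ℚ] (K : Type)) (hord : orderOf g₀ = 2 * n)
    (hcσ : σ₀.comp ((g₀ ^ n : (K : Type) ≃ₐ[ℚ] (K : Type)) : (K : Type) →+* (K : Type)) = conjugate σ₀) (hs2 : s₀ * s₀ = 1)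
    (hgs : g₀ * s₀ = s₀ * g₀) (hs : s₀ ∉ Subgroup.zpowers g₀) (hx2 : x₀ * x₀ = 1) (hxg : x₀ * g₀ * x₀⁻¹ = g₀⁻¹)
    (hxs : x₀ * s₀ * x₀⁻¹ = g₀ ^ n * s₀) (hx : ∀ i j : ℕ, x₀ ≠ g₀ ^ i * s₀ ^ j) (hdeg : Module.finrank ℚ K = 8 * n) :
    ∃ 𝒮 : Finset (Face K), 𝒮.card = fibreTwo (conjT : GalT K) conjT_mul_self ∧
      ((∀ f ∈ 𝒮, ∃ ι₁ : K →+* ℂ, f.Admissible ι₁ ∧ ∃ (V : HermSpace3 K ι₁) (σ : K →+* ℂ),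
        (Model.picardCMUniverse exists_isReal_hodgeModel_holds hodgePQ_independent_of_hodgeModel_holds
          BallQuotient.ballQuotientUniformised_holds cmAbelianVarietyRealised_holds).PeriodNV ι₁ V K f.psi σ) →
      ∀ {P B : AbelianVariety ℂ}, AbelianVariety.IsProductOf (fun B : AbelianVariety ℂ =>
        ∃ (E : Type) (_ : Field E) (_ : NumberField E) (_ : IsCMField E) (_ : E →+* (K : Type)) (Φ : CMType E)
          (ι : 𝓞 E →+* End B) (ϑ : E →+* Module.End ℂ (complexBetti B.X 1)),
          IsCMTypeRealisation Φ B ι ϑ) P →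
      AVDominatedBy B P → HodgeConjectureFor B.dim B.X) := by
  obtain ⟨⟨𝒮, hcard, hgen⟩, -⟩ :=
    isLeast_card_faces_hgen_of_aut_sheared (F := K) σ₀ hn h3 g₀ s₀ x₀ hord hcσ hs2 hgs hs hx2 hxg hxs hx hdeg
  refine ⟨𝒮, hcard, fun h P B hP hB => ?_⟩
  have h6 : 6 ≤ Module.finrank ℚ K := by rw [hdeg]; omega
  exact hodgeConjectureFor_of_avDominatedBy_isProductOf_of_exists_facePeriod_on K h6 (𝒮 : Set (Face K)) σ₀ hgen
    (fun f hf => h f (Finset.mem_coe.mp hf)) hP hB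

end

end Summit.HodgeConjecture.CorCM.FaceShearedDihedral
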